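import Summits.ValiantsHypothesis.ValiantsHypothesis.Theorems.NewtonUnitEquationsTwoProductsRankOneThreeFreeLawShiftPlanar
import HarnessLib

/-!
# Route NewtonUnitEquations — crux `TwoProducts` (stmt-ValiantsHypothesis-5906), line `relation_ladder`, rung R7a (three-term
# rank one, GENERAL shape `α = qβ + rγ`, `q, r ≥ 1`): the FREE LIFT with DOUBLE SLICING — `RankOneThreeFreeLaw` — part 5/6 — per visible point a zero-avoiding strict pencil-minimiser; the fibrewise count (T8, first half)

(T8) `RelData.sliceMin_of_visible`, the width surrogate `Nm7`, the slice bound `sliceBd7`, the per-slice count `sliceCount` (val-lit-p3's `ShiftRank.pencilCount` + `BinExpSum.pencilCount_arith` BY NAME, `toolBound_mono` from the R6 port), `RelData.count`.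

val-idea-8 g3 (ideator; lens decomp), 2026-08-28. Generalises the R6b module (`α = β + γ`, val-lit-p3 g15's port `…RankOneThreeLaw*`,
imported): the substitution `Y_α ↦ Y_β^q Y_γ^r` has fibres `{x + k(e_α − q e_β − r e_γ)}` of letter count `n_k = R + B_k`, `R = Σ_{rest} x_j`,
`B_k = x_β + x_γ − (q+r−1)k ≥ 0`; slicing BOTH relation coordinates `(b₁, b₂) = (x_β, x_γ)` makes `multinomial(L_k)/n_k = Pfac(x) ·
C(R + B_k − 1, B_k) · κ_k` EXACT with `Pfac = (R−1)!/∏_{rest} x_j!`, so the slice functions are R6b's with `(b − k) ↦ B_k` and no binomial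
character — finite SHIFT RANK, and val-lit-p3's `ShiftRank.pencilCount` applies BY NAME.  Large coefficients (`q > m` or `r > m`) force
permutation type (`msetT a e ≤ m`), handled by R3♯ `permTypeLaw_proof`.

PORT NOTE (val-lit-p3 g15, prover seat, helper mode `--supports stmt-ValiantsHypothesis-5906 --as helper`, no stub credit claimed; the
author's invitation val-width INBOX 11:42Z + desk RULING #279 (c)): part 5/6 of a VERBATIM Theorems-side port of val-idea-8 g3's sorry-free
module `Cruxes/TwoProducts/Lines/relation_ladder_R7a.lean` (tree @0a494ab61a34; sha256 2455bfd4f3ef04f6…; 1 627 lines; `lean check` rc 0,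
0 sorries, 0 warnings). ALL mathematics and ALL proofs are val-idea-8 g3's (engine memo `Lines/relation_ladder_R7_engine.md` rev 2 §7).  The
port changes only: (i) the file split and the import chain; (ii) declarations that the source re-declares VERBATIM from the landed R6b port
(`sum_sgn`, `HSD` + `HSD.mul/mulHom/homMul/constMul/sum/add`, `hsd_binChar`, `rW_pos`) or from the R6 port (`tab`, `sgn`, `rW`,
`toolBound_mono`) or from `…FormalLogLinearisationStubRaysRung` (`wt_nsmul'` = `wt_nsmul`) are NOT re-declared but referenced BY NAME
(`R6b.…` for the sibling namespace); (iii) the section variables are renamed `I ↦ Iq` (the `QIdx` datum) and `D ↦ Dq` (the `RelData`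
datum) — a pure α-renaming forced by the gate's statement-text index (`dedup.landed` keys on declaration text, namespace-blind, and
the R6b port owns same-text lemmas over `ThreeIdx`); (iv) one-line docstrings on API lemmas; (v) in part 6/6 the parameter-free
`def RankOneThreeFreeLaw : Prop` is NOT declared (relocation rule) — the law is stated by its LITERAL body as `rankOneThreeFreeLaw_proof`.
Namespace = the author's (`…PermutationType.R7a`).  Nothing here closes the line's residual, the crux `TwoProducts` (5906) or `VP ≠ VNP`;
no summit statement is proved.

Honest scope (the author's): relations with the lone letter carrying a coefficient `p ≥ 2` (e.g. `2β = α + γ` = R6c, `pβ = qα + rγ`), two-letter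
`pα = qβ`, support ≥ 4 and coincidence rank ≥ 2 are NOT covered here.  Nothing here moves VP ≠ VNP; `TwoProducts` (5906) stays OPEN. [folklore]
-/

noncomputable section

-- Sub = Summit single-conjunct layout: the duplicated namespace component is mandated by the tree.
set_option linter.dupNamespace false
set_option linter.unusedSimpArgs false
set_option linter.deprecated false
set_option linter.unusedSectionVars false
set_option linter.unusedVariables false
set_option linter.unnecessarySeqFocus false

namespace Summit.ValiantsHypothesis.ValiantsHypothesis.Theorems.NewtonUnitEquations.TwoProducts.PermutationType
namespace R7a
open scoped BigOperators
open MvPolynomial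

variable {σ : Type*} [Fintype σ] [DecidableEq σ]

variable (Iq : QIdx σ)

/-! ## Part T8: per visible point a zero-avoiding strict pencil-minimiser of a slice function; the fibrewise count over the
slice pairs `(b₁, b₂)` via val-lit-p3's `ShiftRank.pencilCount`; large / absent coefficients are permutation type; the arithmetic;
the law -/

section FreeCount
open Summit.ValiantsHypothesis.ValiantsHypothesis.Theorems.NewtonUnitEquations.TwoProducts.FormalLogLinearisation
open Summit.ValiantsHypothesis.ValiantsHypothesis.Theorems.NewtonUnitEquations.TwoProducts.PlanarCell

variable {m : ℕ} {u v : Fin m → MvPolynomial (Fin 2) ℂ} (Dq : RelData u v)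

/-- **Per visible point.** A visible point `l` (valid `ξ`) yields a toric point `x₀` over it (`x₀(a) = 0`) with slice coordinates
`(x₀(b), x₀(c)) ≤ (q m + m, r m + m)`, whose reduced exponent `x̂₀` is a zero-avoiding STRICT minimiser of the letter-weight
functional on `{ν : F_{x₀(b), x₀(c)}(ν) ≠ 0}` over ALL of `ℕ^s`. [folklore] -/
theorem RelData.sliceMin_of_visible (hu : ∀ j, coeff 0 (u j) = 0) (hv : ∀ j, coeff 0 (v j) = 0)
    (hinj : Set.InjOn (piE (enum u v)) ↑Dq.GT.support) (ξ : Fin 2 → ℝ) (hval : ValidWeight u v ξ) (l : Expo)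
    (htop : IsStrictTop ξ ↑(tailDiff u v).support l) :
    ∃ x₀ : Fin (sE u v) →₀ ℕ, piE (enum u v) x₀ = l ∧ x₀ Dq.idx.a = 0 ∧ x₀ Dq.idx.b ≤ Dq.q * m + m ∧ x₀ Dq.idx.c ≤ Dq.r * m + m ∧
      Fsl Dq.idx (cU u v) (cV u v) (x₀ Dq.idx.b) (x₀ Dq.idx.c) (xhat Dq.idx x₀) ≠ 0 ∧
      ∀ ν : Fin (sE u v) → ℕ, ν ≠ ⇑(xhat Dq.idx x₀) → Fsl Dq.idx (cU u v) (cV u v) (x₀ Dq.idx.b) (x₀ Dq.idx.c) ν ≠ 0 →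
        ∑ i, rW ξ i * ((xhat Dq.idx x₀ i : ℕ) : ℝ) < ∑ i, rW (u := u) (v := v) ξ i * (ν i : ℝ) := by
  classical
  have _hu := hu; have _hv := hv
  obtain ⟨x₀, hx₀, hπ, hmin⟩ := Dq.lifted_of_visible hinj ξ l htop
  obtain ⟨L₀, hL₀, hx₀L⟩ := Dq.exists_of_mem_support_GT x₀ hx₀
  have hx₀a : x₀ Dq.idx.a = 0 := Dq.apply_a_of_mem_support_GT x₀ hx₀
  have hdegL : deg L₀ ≤ m := deg_le_of_mem_support_liftG _ _ L₀ hL₀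
  have hsumL := deg_eq_sum L₀
  rw [sum_three_split Dq.idx] at hsumL
  have hLa : L₀ Dq.idx.a ≤ m := by omega
  have hb_le : x₀ Dq.idx.b ≤ Dq.q * m + m := by
    rw [← hx₀L, piT_frM_b, Dq.idx_q]
    have hqa : Dq.q * L₀ Dq.idx.a ≤ Dq.q * m := Nat.mul_le_mul_left _ hLa
    omega
  have hc_le : x₀ Dq.idx.c ≤ Dq.r * m + m := by
    rw [← hx₀L, piT_frM_c, Dq.idx_r]
    have hra : Dq.r * L₀ Dq.idx.a ≤ Dq.r * m := Nat.mul_le_mul_left _ hLa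
    omega
  -- the upstairs weights and their normalisation
  set θ : Fin (sE u v) → ℝ := rW ξ with hθdef
  have hθpos : ∀ i, 0 < θ i := R6b.rW_pos ξ hval
  have hne : (Finset.univ : Finset (Fin (sE u v))).Nonempty := ⟨Dq.idx.a, Finset.mem_univ _⟩
  set θmin : ℝ := Finset.univ.inf' hne θ with hθmin
  have hθmin_pos : 0 < θmin := by
    obtain ⟨i, -, hi⟩ := Finset.exists_mem_eq_inf' hne θ
    rw [hθmin, hi]; exact hθpos i
  have hθmin_le : ∀ i, θmin ≤ θ i := fun i => Finset.inf'_le θ (Finset.mem_univ i)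
  set θ' : Fin (sE u v) → ℝ := fun i => θ i / θmin with hθ'
  have hθ'1 : ∀ i, 1 ≤ θ' i := fun i => by
    rw [hθ']; simp only; rw [le_div_iff₀ hθmin_pos, one_mul]; exact hθmin_le i
  have hlwt' : ∀ x : Fin (sE u v) →₀ ℕ, lwt θ' x = lwt θ x / θmin := fun x => by
    unfold lwt; rw [Finset.sum_div]
    refine Finset.sum_congr rfl fun i _ => ?_
    rw [hθ']; ring
  have hlwtG : ∀ x ∈ Dq.GT.support, lwt θ x = -wt ξ (piE (enum u v) x) := fun x hx => by
    obtain ⟨L, -, rfl⟩ := Dq.exists_of_mem_support_GT x hx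
    exact Dq.lwt_rW_piT ξ L
  have hminθ' : x₀ ∈ (phiT (frM Dq.idx) (liftG (cU u v) (cV u v))).support ∧
      ∀ x ∈ (phiT (frM Dq.idx) (liftG (cU u v) (cV u v))).support, x ≠ x₀ → lwt θ' x₀ < lwt θ' x := by
    refine ⟨hx₀, fun x hx hne' => ?_⟩
    rw [hlwt', hlwt']
    apply div_lt_div_of_pos_right _ hθmin_pos
    rw [hlwtG x₀ hx₀, hlwtG x hx, hπ]
    linarith [hmin x hx hne']
  have hA := toric_minLog (frM Dq.idx) (frM_ne_zero Dq.idx) θ' hθ'1 (cU u v) (cV u v) x₀ hminθ'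
  set R : ℕ := ⌊lwt θ' x₀⌋₊ + 1 with hRdef
  have hRlt : lwt θ' x₀ < R := by rw [hRdef]; push_cast; exact Nat.lt_floor_add_one _
  -- `x₀ ≠ 0` and `deg x₀ ≤ R`
  have hx₀ne : x₀ ≠ 0 := by
    intro h0
    have := mem_support_iff.mp hx₀
    apply this
    rw [h0]
    unfold RelData.GT
    rw [phiT_liftG, coeff_sub,
      coeff_zero_prod_eq_one _ (fun j => coeff_zero_one_add_phiT_lin (frM Dq.idx) (frM_ne_zero Dq.idx) _),
      coeff_zero_prod_eq_one _ (fun j => coeff_zero_one_add_phiT_lin (frM Dq.idx) (frM_ne_zero Dq.idx) _), sub_self]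
  have hdegR : deg x₀ ≤ R := by
    have h2 : (deg x₀ : ℝ) ≤ lwt θ' x₀ := deg_le_lwt θ' hθ'1 x₀
    have h3 : (deg x₀ : ℝ) < R := lt_of_le_of_lt h2 hRlt
    have h4 : deg x₀ < R := by exact_mod_cast h3
    omega
  have hF0 : Fsl Dq.idx (cU u v) (cV u v) (x₀ Dq.idx.b) (x₀ Dq.idx.c) (xhat Dq.idx x₀) ≠ 0 :=
    (mem_support_free_logTrunc_iff Dq.idx (cU u v) (cV u v) R x₀ hx₀a hx₀ne hdegR).mp hA.1
  refine ⟨x₀, hπ, hx₀a, hb_le, hc_le, hF0, fun ν hν hFν => ?_⟩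
  obtain ⟨hνa, hνb, hνc⟩ := shape_of_Fsl_ne_zero Dq.idx (cU u v) (cV u v) _ _ ν hFν
  set x' : Fin (sE u v) →₀ ℕ := xOf Dq.idx (x₀ Dq.idx.b) (x₀ Dq.idx.c) ν with hx'def
  have hx'a : x' Dq.idx.a = 0 := xOf_a Dq.idx _ _ ν
  have hxh' : ⇑(xhat Dq.idx x') = ν := xhat_xOf Dq.idx _ _ ν hνa hνb hνc
  have hx'b : x' Dq.idx.b = x₀ Dq.idx.b := xOf_b Dq.idx _ _ ν
  have hx'c : x' Dq.idx.c = x₀ Dq.idx.c := xOf_c Dq.idx _ _ ν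
  have hne' : x' ≠ x₀ := by
    intro h; apply hν; rw [← hxh', h]
  have hx'ne : x' ≠ 0 := by
    intro hz
    have hνz : ∀ j, ν j = 0 := fun j => by rw [← hxh', hz]; simp [xhat]
    have hb0 : x₀ Dq.idx.b = 0 := by rw [← hx'b, hz]; rfl
    have hc0 : x₀ Dq.idx.c = 0 := by rw [← hx'c, hz]; rfl
    apply hFν
    rw [hb0, hc0]; exact Fsl_zero_zero Dq.idx (cU u v) (cV u v) ν hνz
  have hlt' : lwt θ' x₀ < lwt θ' x' := by
    by_cases hR' : deg x' ≤ R
    · have hmem : x' ∈ (phiT (frM Dq.idx) (logTrunc (cU u v) (cV u v) R)).support :=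
        (mem_support_free_logTrunc_iff Dq.idx (cU u v) (cV u v) R x' hx'a hx'ne hR').mpr
          (by rw [hx'b, hx'c, hxh']; exact hFν)
      exact hA.2 x' hmem hne'
    · push Not at hR'
      have h2 : (deg x' : ℝ) ≤ lwt θ' x' := deg_le_lwt θ' hθ'1 x'
      have h3 : (R : ℝ) < deg x' := by exact_mod_cast hR'
      linarith
  have hlt : lwt θ x₀ < lwt θ x' := by
    have := hlt'
    rw [hlwt', hlwt'] at this
    exact (div_lt_div_iff_of_pos_right hθmin_pos).mp this
  rw [lwt_split Dq.idx θ x₀ hx₀a, lwt_split Dq.idx θ x' hx'a, hx'b, hx'c] at hlt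
  rw [hxh'] at hlt
  linarith

/-- The uniform width surrogate `N_m = 2 m (2(m² + m) + 1)^2 + 1 ≥ |SIdx m b₁ b₂|` (`b₁, b₂ ≤ m² + m`). [folklore] -/
def Nm7 (m : ℕ) : ℕ := 2 * m * (2 * (m * m + m) + 1) ^ 2 + 1

/-- The slice bound, uniform in `b₁, b₂ ≤ m² + m`. [folklore] -/
def sliceBd7 (m s : ℕ) : ℕ := (s + 2) ^ 3 * (Nm7 m + 2) ^ (3 * (Nat.log 2 (Nm7 m + 2) + 1))

/-- **The per-slice count** from finite shift rank (val-lit-p3's `ShiftRank.pencilCount`, BY NAME). [folklore] -/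
theorem sliceCount (b₁ b₂ : ℕ) (hb : b₁ + b₂ ≤ 2 * (m * m + m)) (U V : Fin (sE u v) → ℝ) (Sb : Finset (Fin (sE u v) → ℕ))
    (hhyp : ∀ μ ∈ Sb, Fsl Dq.idx (cU u v) (cV u v) b₁ b₂ μ ≠ 0 ∧ ∃ t : ℝ, ∀ ν : Fin (sE u v) → ℕ, ν ≠ μ →
      Fsl Dq.idx (cU u v) (cV u v) b₁ b₂ ν ≠ 0 → ∑ i, (U i + t * V i) * (μ i : ℝ) < ∑ i, (U i + t * V i) * (ν i : ℝ)) :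
    Sb.card ≤ sliceBd7 m (sE u v) := by
  obtain ⟨col, ch, hF⟩ := Fsl_shift Dq.idx (cU u v) (cV u v) b₁ b₂
  have h1 := ShiftRank.pencilCount hF U V Sb hhyp
  rw [card_SIdx] at h1
  have h2 := BinExpSum.pencilCount_arith (sE u v) (2 * m * (b₁ + b₂ + 1) ^ 2 + 1)
  have h3 : 2 * m * (b₁ + b₂ + 1) ^ 2 + 1 ≤ Nm7 m :=
    Nat.add_le_add_right (Nat.mul_le_mul_left _ (Nat.pow_le_pow_left (by omega) 2)) 1
  exact h1.trans (h2.trans (toolBound_mono (sE u v) 3 h3))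

/-- **The count for a non-degenerate relation** `α = qβ + rγ` (all three letters in the alphabet, `q, r ≤ m`). [folklore] -/
theorem RelData.count (hu : ∀ j, coeff 0 (u j) = 0) (hv : ∀ j, coeff 0 (v j) = 0) (hqm : Dq.q ≤ m) (hrm : Dq.r ≤ m)
    (hR : RankOneCoincidences (fun j => (u j).support ∪ (v j).support)
      (Finsupp.single Dq.β Dq.q + Finsupp.single Dq.γ Dq.r) (Finsupp.single Dq.α 1))
    (S : Finset Expo) (hS : ∀ l ∈ S, ∃ ξ : Fin 2 → ℝ, ValidWeight u v ξ ∧ IsStrictTop ξ ↑(tailDiff u v).support l) :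
    S.card ≤ (m * m + m + 1) * (m * m + m + 1) * sliceBd7 m (sE u v) := by
  classical
  rcases S.eq_empty_or_nonempty with hSe | hSne
  · simp [hSe]
  obtain ⟨l₀, hl₀⟩ := hSne
  obtain ⟨ξ₀, hval₀, htop₀⟩ := hS l₀ hl₀
  have hTne : (tailSupport u v).Nonempty := tailSupport_nonempty_of_mem u v l₀ htop₀.1
  have hsE : 0 < sE u v := Finset.card_pos.mpr hTne
  set e₀ : Expo := enum u v ⟨0, hsE⟩ with he₀def
  have he₀ : e₀ ≠ 0 := enum_ne_zero u v hu hv _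
  obtain ⟨β, τ, hpencil⟩ := pencil_param e₀ he₀
  have hinj := Dq.injOn_of_rankOne hu hv hR
  have hqmm : Dq.q * m ≤ m * m := Nat.mul_le_mul_right m hqm
  have hrmm : Dq.r * m ≤ m * m := Nat.mul_le_mul_right m hrm
  -- choices along `S`
  have hξ : ∀ x : ↥S, ∃ ξ : Fin 2 → ℝ, ValidWeight u v ξ ∧ IsStrictTop ξ ↑(tailDiff u v).support x.1 :=
    fun x => hS x.1 x.2
  choose ξf hξval hξtop using hξ
  have hpt : ∀ x : ↥S, ∃ x₀ : Fin (sE u v) →₀ ℕ, piE (enum u v) x₀ = x.1 ∧ x₀ Dq.idx.a = 0 ∧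
      x₀ Dq.idx.b ≤ Dq.q * m + m ∧ x₀ Dq.idx.c ≤ Dq.r * m + m ∧
      Fsl Dq.idx (cU u v) (cV u v) (x₀ Dq.idx.b) (x₀ Dq.idx.c) (xhat Dq.idx x₀) ≠ 0 ∧
      ∀ ν : Fin (sE u v) → ℕ, ν ≠ ⇑(xhat Dq.idx x₀) → Fsl Dq.idx (cU u v) (cV u v) (x₀ Dq.idx.b) (x₀ Dq.idx.c) ν ≠ 0 →
        ∑ i, rW (ξf x) i * ((xhat Dq.idx x₀ i : ℕ) : ℝ) < ∑ i, rW (u := u) (v := v) (ξf x) i * (ν i : ℝ) :=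
    fun x => Dq.sliceMin_of_visible hu hv hinj (ξf x) (hξval x) x.1 (hξtop x)
  choose xf hxπ hxa hxb hxc hxF hxmin using hpt
  -- normalisation radii and the pencil parameter
  have hrpos : ∀ x : ↥S, 0 < -wt (ξf x) e₀ := fun x => by
    linarith [wt_enum_neg u v (ξf x) (hξval x) ⟨0, hsE⟩]
  have hnorm : ∀ x : ↥S, wt (fun k => ξf x k / (-wt (ξf x) e₀)) e₀ = -1 := fun x => by
    rw [wt_weight_div]
    have hne : wt (ξf x) e₀ ≠ 0 := by linarith [hrpos x]
    rw [div_neg, div_self hne]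
  have hc : ∀ x : ↥S, ∃ c : ℝ, ∀ e : Expo, wt (fun k => ξf x k / (-wt (ξf x) e₀)) e = wt β e + c * wt τ e :=
    fun x => hpencil _ (hnorm x)
  choose cf hcf using hc
  set U : Fin (sE u v) → ℝ := fun i => -wt β (enum u v i) with hU
  set V : Fin (sE u v) → ℝ := fun i => -wt τ (enum u v i) with hV
  have hUV : ∀ (x : ↥S) (i : Fin (sE u v)),
      U i + cf x * V i = rW (ξf x) i / (-wt (ξf x) e₀) := fun x i => by
    have h := hcf x (enum u v i)
    rw [wt_weight_div] at h
    rw [hU, hV]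
    unfold rW
    simp only
    rw [neg_div, h]
    ring
  have hsumUV : ∀ (x : ↥S) (ν : Fin (sE u v) → ℕ), ∑ i, (U i + cf x * V i) * (ν i : ℝ) =
      (∑ i, rW (ξf x) i * (ν i : ℝ)) / (-wt (ξf x) e₀) := fun x ν => by
    rw [Finset.sum_div]
    refine Finset.sum_congr rfl fun i _ => ?_
    rw [hUV x i]
    ring
  -- the key map `l ↦ ((b₁, b₂), x̂₀)` is injective
  set key : ↥S → (ℕ × ℕ) × (Fin (sE u v) → ℕ) :=
    fun x => ((xf x Dq.idx.b, xf x Dq.idx.c), ⇑(xhat Dq.idx (xf x))) with hkey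
  have hinjK : Function.Injective key := by
    intro x y h
    rw [hkey] at h
    simp only [Prod.mk.injEq] at h
    have hx : xf x = xf y := by
      rw [← xOf_xhat Dq.idx (xf x) (hxa x), ← xOf_xhat Dq.idx (xf y) (hxa y), h.1.1, h.1.2]
      exact congrArg _ h.2
    apply Subtype.ext
    rw [← hxπ x, ← hxπ y, hx]
  set Img : Finset ((ℕ × ℕ) × (Fin (sE u v) → ℕ)) := (Finset.univ : Finset ↥S).image key with hImg
  have hcard : Img.card = S.card := by
    rw [hImg, Finset.card_image_of_injective _ hinjK, Finset.card_univ, Fintype.card_coe]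
  set Box : Finset (ℕ × ℕ) := Finset.range (m * m + m + 1) ×ˢ Finset.range (m * m + m + 1) with hBox
  have hfst : ∀ p ∈ Img, p.1 ∈ Box := by
    intro p hp
    obtain ⟨x, -, rfl⟩ := Finset.mem_image.mp hp
    rw [hBox, Finset.mem_product, Finset.mem_range, Finset.mem_range]
    have h1 := hxb x
    have h2 := hxc x
    rw [hkey]
    simp only
    constructor <;> omega
  have hfib : ∀ bc ∈ Box, (Img.filter fun p => p.1 = bc).card ≤ sliceBd7 m (sE u v) := by
    intro bc hbc
    rw [hBox, Finset.mem_product, Finset.mem_range, Finset.mem_range] at hbc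
    have hbsum : bc.1 + bc.2 ≤ 2 * (m * m + m) := by omega
    set Sb : Finset (Fin (sE u v) → ℕ) := (Img.filter fun p => p.1 = bc).image Prod.snd with hSb
    have hcardb : (Img.filter fun p => p.1 = bc).card = Sb.card := by
      rw [hSb, Finset.card_image_of_injOn]
      intro p hp p' hp' hpq
      have h1 := (Finset.mem_filter.mp (Finset.mem_coe.mp hp)).2
      have h2 := (Finset.mem_filter.mp (Finset.mem_coe.mp hp')).2
      exact Prod.ext (h1.trans h2.symm) hpq
    rw [hcardb]
    refine sliceCount Dq bc.1 bc.2 hbsum U V Sb fun μ hμ => ?_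
    obtain ⟨p, hp, rfl⟩ := Finset.mem_image.mp hμ
    obtain ⟨hpI, hpb⟩ := Finset.mem_filter.mp hp
    obtain ⟨x, -, rfl⟩ := Finset.mem_image.mp hpI
    rw [hkey] at hpb ⊢
    simp only at hpb ⊢
    have hb1 : xf x Dq.idx.b = bc.1 := by rw [← hpb]
    have hb2 : xf x Dq.idx.c = bc.2 := by rw [← hpb]
    refine ⟨?_, cf x, fun ν hν hFν => ?_⟩
    · have := hxF x
      rw [hb1, hb2] at this
      exact this
    · have hFν' : Fsl Dq.idx (cU u v) (cV u v) (xf x Dq.idx.b) (xf x Dq.idx.c) ν ≠ 0 := by rw [hb1, hb2]; exact hFν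
      have hlt := hxmin x ν hν hFν'
      rw [hsumUV x, hsumUV x ν]
      exact div_lt_div_of_pos_right hlt (hrpos x)
  rw [← hcard, Finset.card_eq_sum_card_fiberwise hfst]
  calc ∑ bc ∈ Box, (Img.filter fun p => p.1 = bc).card
      ≤ ∑ bc ∈ Box, sliceBd7 m (sE u v) := Finset.sum_le_sum hfib
    _ = (m * m + m + 1) * (m * m + m + 1) * sliceBd7 m (sE u v) := by
        rw [Finset.sum_const, smul_eq_mul, hBox, Finset.card_product, Finset.card_range]

end FreeCount

end R7a
end Summit.ValiantsHypothesis.ValiantsHypothesis.Theorems.NewtonUnitEquations.TwoProducts.PermutationType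

end
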